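import Summits.NavierStokesRegularity.NavierStokesRegularity.Theorems.ExtremiserTransienceSparseBangBangDefs
import Summits.NavierStokesRegularity.NavierStokesRegularity.Theorems.ExtremiserTransienceHigherTypeIRates
import Summits.NavierStokesRegularity.NavierStokesRegularity.Theorems.ExtremiserTransiencePlateauZoom
import Summits.NavierStokesRegularity.NavierStokesRegularity.Theorems.ExtremiserTransienceNearExtremalTransienceThetaOne
import Summits.NavierStokesRegularity.NavierStokesRegularity.Theorems.ExtremiserTransienceNearExtremalTransienceSharpConstant
import Summits.NavierStokesRegularity.NavierStokesRegularity.Theorems.TypeICertificateLadderRungReynoldsOneTaoCover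
import HarnessLib

/-!
# Route `ExtremiserTransience`, crux `NearExtremalTransiencePerFlow` (stmt-NavierStokesRegularity-26567), LINE g8-α «sparse bang-bang»:
# STUB S-T `SparseSliceTransfer` PROVED (by name, over the texts of record)

`--supports stmt-NavierStokesRegularity-26567` (helper: LINE g8-α = crux workfile `Cruxes/NearExtremalTransiencePerFlow/Lines/sparse_bangbang.lean`,
PASS idea-crit-4 2026-08-28T21:06:12Z, not the registered skeleton of record).  Also step (T2)–(T4) of item 28318 `RegularisedSliceTransfer` at
the sparse times.  Author: prover seat `ns-net-p1` (g2).

`sparseSliceTransfer : SparseSliceTransfer`, i.e. `SparseNearPlateauStability → SparseEfficientTimes → ∀ violator, WeakPlateauObject`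
(vocabulary `…Theorems.NearExtremalTransiencePerFlow.SparseBangBang.*` = the line's §0–§1 verbatim; in the line's file
`theorem stub_sparseSliceTransfer : … := sparseSliceTransfer` closes by definitional unfolding).  THE ASSEMBLY (plan T1–T4 of the line):
* (T1) all-order Type-I rates `‖Dʲu(t)‖ ≤ C_j(√ν/√(T−t))(√(ν(T−t)))^{−j}` eventually — LANDED `ExtremiserTransience.higherTypeIRates`;
* (T2) at a time `t` given by S-E (sparse, two-sided locked `Θ⁻¹ν(T−t)P ≤ Z ≤ Θν(T−t)P`, `(κ⋆−ε')`-efficient at a height `M` with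
  `0 < M√Z√P`), the slice `u(t)` is ADMISSIBLE (smooth, divergence free, slab budgets `stub_taoCover`), `A`-REGULAR with the per-flow budget
  `A_j = max 1 (C_j Θ'^j / c_L)` (`Θ' = max Θ 1`; Leray's lower rate `c_L√ν ≤ √(T−t)‖u(t)‖_∞ ≤ √(T−t)M`, `lerayLowerRate_of_not_extends`, and
  `λ = √(Z/P) ≤ Θ'√(ν(T−t))`), `N_sp`-SPARSE with `N_sp = Θ'² N₁/c_L²` (`N₁ = max N₀ 1`; `Pλ = Z/λ`, `λ ≥ √(ν(T−t))/Θ'`, sparseness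
  `Z√(T−t) ≤ N₀ν^{3/2}`), and its height is PINNED: `min(c_L, 2C)√ν ≤ √(T−t)M ≤ 2C√ν` (universality of `κ⋆` at the Type-I height,
  `flowwise_of_universal sharpDepletion_is_universal`, once `ε' ≤ κ⋆/2`);
* (T3) S-B with `(A, N_sp)` gives `c₀, r` and, for every `δ`, an `ε(δ)`; running S-E at `ε' = min ε (κ⋆/2)` past any onset yields a fat near-top
  ball `vol{x ∈ B(x₀, rλ) : ‖u(t,x)‖ ≥ (1−δ)M} ≥ c₀(rλ)³`, which in parabolic units is `≥ (c₀/Θ'⁶)(rΘ'√(ν(T−t)))³` inside `B(x₀, rΘ'√(ν(T−t)))`;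
* (T4) the LANDED plateau zoom `ExtremiserTransience.plateauZoom` turns these data into the weak one-slice plateau object.
HONEST FRAMING: an implication between statements about hypothetical Type-I singular flows (S-B is being proved by seat ns-net-p2; S-E is the
line's OPEN HEART); nothing about Navier–Stokes regularity or blow-up is proved; no summit is proved by a line. [folklore]
-/

noncomputable section

open scoped Topology InnerProductSpace RealInnerProductSpace ENNReal ContDiff
open MeasureTheory Filter Set Metric Function
open Literature.Analysis Literature.Analysis.FluidPDE
open Summit.NavierStokesRegularity.NavierStokesRegularity.Theorems.DepletionLadder.KStar
open Summit.NavierStokesRegularity.NavierStokesRegularity.Theorems.DepletionLadder.KStar.HalfSpace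
open Summit.NavierStokesRegularity.NavierStokesRegularity.Theorems.DepletionLadder.KStar.BangBang
open Summit.NavierStokesRegularity.NavierStokesRegularity.Theorems.NearExtremalTransiencePerFlow.ZoneTransversality (PFC IsViolator)
open Summit.NavierStokesRegularity.NavierStokesRegularity.Theorems.ExtremiserTransience

namespace Summit.NavierStokesRegularity.NavierStokesRegularity.Theorems.NearExtremalTransiencePerFlow.SparseBangBang

-- the problem directory repeats the summit name (`NavierStokesRegularity/NavierStokesRegularity`)
set_option linter.dupNamespace false

/-- Slab budgets of the slices of a classical Leray–Hopf rapidly-decaying-datum flow: every `∫ ‖Dᵏu(t)‖²` is finite on `[0,T)`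
(Tao's cover, landed `RungReynoldsOne.stub_taoCover`). [folklore] -/
theorem lintegral_iteratedFDeriv_slice_lt_top {ν T : ℝ} (hν : 0 < ν) (hT : 0 < T)
    {u : ℝ → EuclideanSpace ℝ (Fin 3) → EuclideanSpace ℝ (Fin 3)} {p : ℝ → EuclideanSpace ℝ (Fin 3) → ℝ}
    (hsol : IsClassicalNSSolutionOn (Set.Ico 0 T) ν 0 u p) (hLH : IsLerayHopfOn T ν 0 (u 0) u)
    (hdec : HasRapidSpatialDecay (u 0)) {t : ℝ} (ht : t ∈ Set.Ico 0 T) (k : ℕ) :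
    ∫⁻ x, ‖iteratedFDeriv ℝ k (u t) x‖ₑ ^ 2 < ⊤ := by
  have ht' : (t + T) / 2 ∈ Ioo 0 T := ⟨by linarith [ht.1], by linarith [ht.2]⟩
  obtain ⟨q, -, hut, -, -⟩ := RungReynoldsOne.stub_taoCover hν hT hsol hLH hdec ht'
  obtain ⟨Ck, hCk⟩ := hut k
  exact (hCk t ⟨ht.1, by linarith [ht.2]⟩).trans_lt ENNReal.coe_lt_top

/-- The two-sided scale lock in parabolic units (pure real arithmetic): if `Θ⁻¹·X·P ≤ Z ≤ Θ·X·P` with `P, X, Θ > 0` and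
`Θ ≤ Θ'`, `1 ≤ Θ'`, then `√X/Θ' ≤ √(Z/P) ≤ Θ'·√X`. [folklore] -/
theorem sqrt_div_bounds_of_lock {Z P X Θ Θ' : ℝ} (hP : 0 < P) (hX : 0 < X) (hΘ : 0 < Θ) (hΘΘ' : Θ ≤ Θ') (h1 : 1 ≤ Θ')
    (hlo : Θ⁻¹ * X * P ≤ Z) (hup : Z ≤ Θ * X * P) :
    Real.sqrt (Z / P) ≤ Θ' * Real.sqrt X ∧ Real.sqrt X / Θ' ≤ Real.sqrt (Z / P) := by
  have hΘ' : 0 < Θ' := lt_of_lt_of_le one_pos h1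
  have hΘ'2 : Θ' ≤ Θ' ^ 2 := by nlinarith
  constructor
  · -- `Z/P ≤ Θ X ≤ Θ'² X`
    have h2 : Z / P ≤ Θ' ^ 2 * X := by
      rw [div_le_iff₀ hP]
      calc Z ≤ Θ * X * P := hup
        _ ≤ Θ' ^ 2 * X * P := by gcongr; exact hΘΘ'.trans hΘ'2
    calc Real.sqrt (Z / P) ≤ Real.sqrt (Θ' ^ 2 * X) := Real.sqrt_le_sqrt h2
      _ = Θ' * Real.sqrt X := by rw [Real.sqrt_mul (sq_nonneg _), Real.sqrt_sq hΘ'.le]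
  · -- `X/Θ'² ≤ Θ⁻¹ X ≤ Z/P`
    have h2 : X / Θ' ^ 2 ≤ Z / P := by
      rw [div_le_div_iff₀ (pow_pos hΘ' 2) hP]
      have h3 : X * P ≤ Θ * Z := by
        have e : Θ * (Θ⁻¹ * X * P) = X * P := by field_simp
        rw [← e]; exact mul_le_mul_of_nonneg_left hlo hΘ.le
      calc X * P ≤ Θ * Z := h3
        _ ≤ Θ' ^ 2 * Z := by
            have hZ : 0 ≤ Z := le_trans (by positivity) hlo
            exact mul_le_mul_of_nonneg_right (hΘΘ'.trans hΘ'2) hZ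
        _ = Z * Θ' ^ 2 := mul_comm _ _
    calc Real.sqrt X / Θ' = Real.sqrt (X / Θ' ^ 2) := by
          rw [Real.sqrt_div' _ (sq_nonneg _), Real.sqrt_sq hΘ'.le]
      _ ≤ Real.sqrt (Z / P) := Real.sqrt_le_sqrt h2

/-- Height pinning from above (pure real arithmetic): efficiency `(κ⋆−ε')·M·a·b ≤ J` at a deficit `ε' ≤ κ⋆/2` against the universal
bound `J ≤ κ⋆·Mt·a·b` (`a, b > 0`) forces `M ≤ 2·Mt`. [folklore] -/
theorem height_le_two_mul_of_efficient {κ ε M Mt a b J : ℝ} (hκ : 0 < κ) (hε : ε ≤ κ / 2) (hM : 0 ≤ M) (ha : 0 < a) (hb : 0 < b)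
    (heff : (κ - ε) * M * a * b ≤ J) (huniv : J ≤ κ * Mt * a * b) : M ≤ 2 * Mt := by
  have hab : 0 < a * b := mul_pos ha hb
  have h1 : κ / 2 * M * (a * b) ≤ (κ - ε) * M * (a * b) :=
    mul_le_mul_of_nonneg_right (mul_le_mul_of_nonneg_right (by linarith) hM) hab.le
  have h2 : (κ - ε) * M * (a * b) ≤ κ * Mt * (a * b) := by
    have h := heff.trans huniv
    simpa only [mul_assoc] using h
  have h3 : κ / 2 * M ≤ κ * Mt := le_of_mul_le_mul_right (h1.trans h2) hab
  have h4 : κ * (M / 2) ≤ κ * Mt := by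
    calc κ * (M / 2) = κ / 2 * M := by ring
      _ ≤ κ * Mt := h3
  have h5 : M / 2 ≤ Mt := le_of_mul_le_mul_left h4 hκ
  linarith

/-- Sparseness in units of the height (pure real arithmetic): with `L² = Z/P`, `L ≥ √(ν·τ)/Θ'`, sparseness `Z·√τ ≤ N₁·ν^{3/2}` and
Leray's pinning `c_L√ν ≤ √τ·M`, one has `P·L ≤ (Θ'²N₁/c_L²)·M²`. [folklore] -/
theorem palinstrophy_mul_length_le {ν τ Z P L M cL Θ' N₁ : ℝ} (hν : 0 < ν) (hτ : 0 < τ) (hZ : 0 < Z) (hP : 0 < P)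
    (hcL : 0 < cL) (hΘ' : 1 ≤ Θ') (hN₁ : 0 ≤ N₁) (hL : 0 < L) (hL2 : L ^ 2 = Z / P)
    (hLlow : Real.sqrt (ν * τ) / Θ' ≤ L) (hsparse : Z * Real.sqrt τ ≤ N₁ * (ν * Real.sqrt ν))
    (hpin : cL * Real.sqrt ν ≤ Real.sqrt τ * M) : P * L ≤ Θ' ^ 2 * N₁ / cL ^ 2 * M ^ 2 := by
  have hsν : 0 < Real.sqrt ν := Real.sqrt_pos.2 hν
  have hsτ : 0 < Real.sqrt τ := Real.sqrt_pos.2 hτ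
  have hΘ'pos : 0 < Θ' := lt_of_lt_of_le one_pos hΘ'
  have hsX : Real.sqrt (ν * τ) = Real.sqrt ν * Real.sqrt τ := Real.sqrt_mul hν.le _
  have hsXpos : 0 < Real.sqrt (ν * τ) := Real.sqrt_pos.2 (mul_pos hν hτ)
  -- `P·L = Z/L`
  have e1 : P * L = Z / L := by
    rw [eq_div_iff hL.ne', mul_assoc, ← pow_two, hL2, mul_div_cancel₀ _ hP.ne']
  -- `Z/(√ν√τ) ≤ N₁ ν/τ`
  have hZX : Z / (Real.sqrt ν * Real.sqrt τ) ≤ N₁ * ν / τ := by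
    rw [div_le_div_iff₀ (mul_pos hsν hsτ) hτ]
    have h2 := mul_le_mul_of_nonneg_right hsparse hsτ.le
    calc Z * τ = Z * Real.sqrt τ * Real.sqrt τ := by rw [mul_assoc, Real.mul_self_sqrt hτ.le]
      _ ≤ N₁ * (ν * Real.sqrt ν) * Real.sqrt τ := h2
      _ = N₁ * ν * (Real.sqrt ν * Real.sqrt τ) := by ring
  -- `ν/τ ≤ M²/c_L²`
  have hντ : ν / τ ≤ M ^ 2 / cL ^ 2 := by
    have h := pow_le_pow_left₀ (by positivity) hpin 2
    rw [mul_pow, mul_pow, Real.sq_sqrt hν.le, Real.sq_sqrt hτ.le] at h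
    rw [div_le_div_iff₀ hτ (by positivity)]
    linarith
  calc P * L = Z / L := e1
    _ ≤ Z / (Real.sqrt (ν * τ) / Θ') := div_le_div_of_nonneg_left hZ.le (div_pos hsXpos hΘ'pos) hLlow
    _ = Θ' * (Z / (Real.sqrt ν * Real.sqrt τ)) := by rw [hsX]; field_simp
    _ ≤ Θ' * (N₁ * ν / τ) := mul_le_mul_of_nonneg_left hZX hΘ'pos.le
    _ = Θ' * N₁ * (ν / τ) := by ring
    _ ≤ Θ' * N₁ * (M ^ 2 / cL ^ 2) := mul_le_mul_of_nonneg_left hντ (by positivity)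
    _ ≤ Θ' ^ 2 * N₁ * (M ^ 2 / cL ^ 2) := by
        have : Θ' ≤ Θ' ^ 2 := by nlinarith
        gcongr
    _ = Θ' ^ 2 * N₁ / cL ^ 2 * M ^ 2 := by ring

/-- **S-T `SparseSliceTransfer` of LINE g8-α, PROVED** (assembly T1–T4; see the module docstring).  [folklore] -/
theorem sparseSliceTransfer : SparseSliceTransfer := by
  intro hSB hSE C ν T u p hV
  have hV' := hV
  obtain ⟨hC, hν, hT, hsol, hLH, hdec, hrate, hext, hno⟩ := hV'
  have hsν : 0 < Real.sqrt ν := Real.sqrt_pos.2 hν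
  have hK : 0 < kStar := kStar_pos
  -- ### per-flow constants
  -- Leray's lower rate
  obtain ⟨cL, hcL, hler⟩ := DepletionLadder.PerFlow.lerayLowerRate_of_not_extends hν hT hsol hLH hdec hext
  -- (T1) all-order Type-I rates past `tA`
  obtain ⟨Cs, hCs⟩ := higherTypeIRates C ν T hC hν hT u p hsol hLH hdec hrate
  obtain ⟨tA, htA, hsubA⟩ := mem_nhdsLT_iff_exists_Ioo_subset.1 hCs
  have htAT : tA < T := htA
  -- the Type-I rate past `tB`
  obtain ⟨tB, htB, hsubB⟩ := mem_nhdsLT_iff_exists_Ioo_subset.1 hrate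
  have htBT : tB < T := htB
  -- universality of `κ⋆` along the flow
  have hfw := DepletionLadder.flowwise_of_universal DepletionLadder.sharpDepletion_is_universal hν hT hsol hLH hdec
  -- the sparse efficient times of the flow (S-E)
  obtain ⟨N₀, Θ, hSEu⟩ := hSE C ν T u p hV
  set Θ' : ℝ := max Θ 1 with hΘ'def
  have hΘ'1 : 1 ≤ Θ' := le_max_right _ _
  have hΘ'pos : 0 < Θ' := lt_of_lt_of_le one_pos hΘ'1
  have hΘΘ' : Θ ≤ Θ' := le_max_left _ _
  set N₁ : ℝ := max N₀ 1 with hN₁def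
  have hN₁1 : 1 ≤ N₁ := le_max_right _ _
  have hN₀N₁ : N₀ ≤ N₁ := le_max_left _ _
  -- the per-flow regularity budget and sparseness level
  set A : ℕ → ℝ := fun j => max 1 (Cs j * Θ' ^ j / cL) with hAdef
  have hA1 : ∀ j, 1 ≤ A j := fun j => le_max_left _ _
  set Nsp : ℝ := Θ' ^ 2 * N₁ / cL ^ 2 with hNspdef
  have hNsp : 0 < Nsp := by positivity
  -- ### S-B at `(A, Nsp)`
  obtain ⟨c₀, r, hc₀, hr, hSBδ⟩ := hSB A hA1 Nsp hNsp
  -- ### the data for the plateau zoom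
  have key : ∃ c₀' r' cl ch : ℝ, 0 < c₀' ∧ 0 < r' ∧ 0 < cl ∧ cl ≤ ch ∧ ∀ δ : ℝ, 0 < δ → ∀ t₁ ∈ Set.Ico 0 T,
      ∃ t ∈ Set.Ico t₁ T, ∃ (M : ℝ) (x₀ : EuclideanSpace ℝ (Fin 3)), (∀ x, ‖u t x‖ ≤ M) ∧
        cl * Real.sqrt ν ≤ Real.sqrt (T - t) * M ∧ Real.sqrt (T - t) * M ≤ ch * Real.sqrt ν ∧
        ENNReal.ofReal (c₀' * (r' * Real.sqrt (ν * (T - t))) ^ 3) ≤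
          MeasureTheory.volume {x : EuclideanSpace ℝ (Fin 3) | x ∈ Metric.ball x₀ (r' * Real.sqrt (ν * (T - t))) ∧
            (1 - δ) * M ≤ ‖u t x‖} := by
    refine ⟨c₀ / Θ' ^ 6, r * Θ', min cL (2 * C), 2 * C, by positivity, by positivity, lt_min hcL (by positivity),
      min_le_right _ _, fun δ hδ t₁ ht₁ => ?_⟩
    obtain ⟨ε, hε, hSBv⟩ := hSBδ δ hδ
    set ε' : ℝ := min ε (kStar / 2) with hε'def
    have hε' : 0 < ε' := lt_min hε (half_pos hK)
    have hε'ε : ε' ≤ ε := min_le_left _ _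
    have hε'K : ε' ≤ kStar / 2 := min_le_right _ _
    -- the onset: past `t₁`, `T/2`, and the onsets of (T1) and of the Type-I rate
    set t₂ : ℝ := max (max t₁ (T / 2)) (max ((tA + T) / 2) ((tB + T) / 2)) with ht₂def
    have ht₂T : t₂ < T :=
      max_lt (max_lt ht₁.2 (by linarith)) (max_lt (by linarith) (by linarith))
    have ht₂0 : 0 ≤ t₂ := le_trans (by linarith : (0 : ℝ) ≤ T / 2) ((le_max_right _ _).trans (le_max_left _ _))
    obtain ⟨t, ht, hsparse, hlockl, hlocku, M, hM, hpos, heff⟩ := hSEu ε' hε' t₂ ⟨ht₂0, ht₂T⟩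
    -- where `t` sits
    have htT : t < T := ht.2
    have hTt : 0 < T - t := sub_pos.2 htT
    have ht₁t : t₁ ≤ t := le_trans ((le_max_left _ _).trans (le_max_left _ _)) ht.1
    have htI : t ∈ Set.Ico 0 T := ⟨ht₁.1.trans ht₁t, htT⟩
    have htAt : tA < t := lt_of_lt_of_le (by linarith) (((le_max_left _ _).trans (le_max_right _ _)).trans ht.1)
    have htBt : tB < t := lt_of_lt_of_le (by linarith) (((le_max_right _ _).trans (le_max_right _ _)).trans ht.1)
    have hsT : 0 < Real.sqrt (T - t) := Real.sqrt_pos.2 hTt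
    -- abbreviations
    set Z : ℝ := Zen (u t) with hZdef
    set P : ℝ := Wpa (u t) with hPdef
    set X : ℝ := ν * (T - t) with hXdef
    have hX : 0 < X := mul_pos hν hTt
    have hsX : Real.sqrt X = Real.sqrt ν * Real.sqrt (T - t) := Real.sqrt_mul hν.le _
    have hsXpos : 0 < Real.sqrt X := Real.sqrt_pos.2 hX
    -- positivity of `M`, `Z`, `P`
    have hMnn : 0 ≤ M := (norm_nonneg _).trans (hM 0)
    have hM0 : 0 < M := by
      rcases hMnn.eq_or_lt with h | h
      · rw [← h, zero_mul, zero_mul] at hpos; exact absurd hpos (lt_irrefl _)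
      · exact h
    have hsZ : 0 < Real.sqrt Z := by
      rcases (Real.sqrt_nonneg Z).eq_or_lt with h | h
      · rw [← h, mul_zero, zero_mul] at hpos; exact absurd hpos (lt_irrefl _)
      · exact h
    have hsP : 0 < Real.sqrt P := by
      rcases (Real.sqrt_nonneg P).eq_or_lt with h | h
      · rw [← h, mul_zero] at hpos; exact absurd hpos (lt_irrefl _)
      · exact h
    have hZ : 0 < Z := Real.sqrt_pos.1 hsZ
    have hP : 0 < P := Real.sqrt_pos.1 hsP
    have hSZP : 0 < Real.sqrt Z * Real.sqrt P := mul_pos hsZ hsP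
    -- `Θ > 0` (the upper lock with `Z > 0`)
    have hΘ : 0 < Θ := by
      by_contra h
      push Not at h
      have : Θ * (ν * (T - t)) * Wpa (u t) ≤ 0 :=
        mul_nonpos_of_nonpos_of_nonneg (mul_nonpos_of_nonpos_of_nonneg h hX.le) hP.le
      linarith
    -- sparseness at level `N₁ ≥ N₀`
    have hsparse' : Z * Real.sqrt (T - t) ≤ N₁ * (ν * Real.sqrt ν) :=
      hsparse.trans (mul_le_mul_of_nonneg_right hN₀N₁ (by positivity))
    -- the Taylor length `λ = √(Z/P)` in parabolic units
    have hlamZP : lam (u t) = Real.sqrt (Z / P) := rfl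
    obtain ⟨hlamU, hlamL⟩ := sqrt_div_bounds_of_lock hP hX hΘ hΘΘ' hΘ'1 hlockl hlocku
    rw [← hlamZP] at hlamU hlamL
    have hlam : 0 < lam (u t) := lt_of_lt_of_le (div_pos hsXpos hΘ'pos) hlamL
    -- Leray at `t`: `cL √ν ≤ √(T−t) M`, hence `√ν/√(T−t) ≤ M/cL` and `ν/(T−t) ≤ M²/cL²`
    have hpinl : cL * Real.sqrt ν ≤ Real.sqrt (T - t) * M := by
      obtain ⟨xL, hxL⟩ := hler t htI
      exact hxL.trans (mul_le_mul_of_nonneg_left (hM xL) (Real.sqrt_nonneg _))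
    have hsle : Real.sqrt ν / Real.sqrt (T - t) ≤ M / cL := by
      rw [div_le_div_iff₀ hsT hcL]
      calc Real.sqrt ν * cL = cL * Real.sqrt ν := mul_comm _ _
        _ ≤ Real.sqrt (T - t) * M := hpinl
        _ = M * Real.sqrt (T - t) := mul_comm _ _
    have hνT : ν / (T - t) ≤ M ^ 2 / cL ^ 2 := by
      have h := pow_le_pow_left₀ (by positivity) hpinl 2
      rw [mul_pow, mul_pow, Real.sq_sqrt hν.le, Real.sq_sqrt hTt.le] at h
      rw [div_le_div_iff₀ hTt (by positivity)]
      linarith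
    -- the Type-I height at `t` and the upper pinning `√(T−t) M ≤ 2C√ν`
    set Mt : ℝ := C * Real.sqrt ν / Real.sqrt (T - t) with hMtdef
    have hMt : ∀ x, ‖u t x‖ ≤ Mt := fun x => by
      have h := hsubB ⟨htBt, htT⟩ x
      rw [hMtdef, le_div_iff₀ hsT, mul_comm]; exact h
    have hJ : |Jst (u t)| ≤ kStar * Mt * Real.sqrt Z * Real.sqrt P := by
      have h := hfw t htI Mt hMt
      simp only [Jst, hZdef, hPdef, Zen, Wpa, kStar, udcSet]
      exact h
    have hpinu : Real.sqrt (T - t) * M ≤ 2 * C * Real.sqrt ν := by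
      have h5 : M ≤ 2 * Mt := height_le_two_mul_of_efficient hK hε'K hM0.le hsZ hsP heff hJ
      calc Real.sqrt (T - t) * M ≤ Real.sqrt (T - t) * (2 * Mt) := mul_le_mul_of_nonneg_left h5 hsT.le
        _ = 2 * C * Real.sqrt ν := by rw [hMtdef]; field_simp
    -- (T1) at `t`: `‖Dʲu(t)‖ ≤ Cs j · s · qʲ` with `s = √ν/√(T−t) ≤ M/cL`, `q = (√X)⁻¹ ≤ Θ' λ⁻¹`
    have hD : ∀ (j : ℕ) (x : EuclideanSpace ℝ (Fin 3)), ‖iteratedFDeriv ℝ j (u t) x‖ ≤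
        Cs j * (Real.sqrt ν / Real.sqrt (T - t)) * (Real.sqrt (ν * (T - t)))⁻¹ ^ j := hsubA ⟨htAt, htT⟩
    have hs0 : 0 < Real.sqrt ν / Real.sqrt (T - t) := div_pos hsν hsT
    have hq0 : 0 < (Real.sqrt (ν * (T - t)))⁻¹ := inv_pos.2 hsXpos
    have hqle : (Real.sqrt (ν * (T - t)))⁻¹ ≤ Θ' * (lam (u t))⁻¹ := by
      rw [← div_eq_mul_inv, le_div_iff₀ hlam, inv_mul_le_iff₀ hsXpos, mul_comm]
      exact hlamU
    have hCs0 : ∀ j, 0 ≤ Cs j := fun j => by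
      by_contra h
      push Not at h
      have h1 := hD j 0
      have h2 : Cs j * (Real.sqrt ν / Real.sqrt (T - t)) * (Real.sqrt (ν * (T - t)))⁻¹ ^ j < 0 :=
        mul_neg_of_neg_of_pos (mul_neg_of_neg_of_pos h hs0) (pow_pos hq0 j)
      linarith [norm_nonneg (iteratedFDeriv ℝ j (u t) 0)]
    have hReg : IsReg A (u t) M := by
      intro j x
      calc ‖iteratedFDeriv ℝ j (u t) x‖ ≤ Cs j * (Real.sqrt ν / Real.sqrt (T - t)) * (Real.sqrt (ν * (T - t)))⁻¹ ^ j :=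
            hD j x
        _ ≤ Cs j * (M / cL) * (Θ' * (lam (u t))⁻¹) ^ j :=
            mul_le_mul (mul_le_mul_of_nonneg_left hsle (hCs0 j)) (pow_le_pow_left₀ hq0.le hqle j)
              (pow_nonneg hq0.le j) (mul_nonneg (hCs0 j) (div_nonneg hM0.le hcL.le))
        _ = Cs j * Θ' ^ j / cL * M * (lam (u t))⁻¹ ^ j := by rw [mul_pow]; ring
        _ ≤ A j * M * (lam (u t))⁻¹ ^ j :=
            mul_le_mul_of_nonneg_right (mul_le_mul_of_nonneg_right (le_max_right _ _) hM0.le)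
              (pow_nonneg (inv_nonneg.2 hlam.le) j)
    -- admissibility of the slice
    set B : ℝ := A 1 * M * (lam (u t))⁻¹ ^ 1 with hBdef
    have hAdm : IsAdm (u t) M B := by
      refine ⟨hsol.contDiff_velocity htI, hsol.divFree _ htI, hM, fun x => ?_,
        lintegral_iteratedFDeriv_slice_lt_top hν hT hsol hLH hdec htI 0,
        lintegral_iteratedFDeriv_slice_lt_top hν hT hsol hLH hdec htI 1,
        lintegral_iteratedFDeriv_slice_lt_top hν hT hsol hLH hdec htI 2⟩
      rw [← norm_iteratedFDeriv_one (𝕜 := ℝ)]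
      exact hReg 1 x
    -- sparseness of the slice: `P·λ = Z/λ ≤ Θ' Z/√X ≤ Θ' N₁ ν/(T−t) ≤ Nsp·M²`
    have hSparse : IsSparse Nsp (u t) M := by
      show Wpa (u t) * lam (u t) ≤ Θ' ^ 2 * N₁ / cL ^ 2 * M ^ 2
      have hlam2 : lam (u t) ^ 2 = Z / P := by rw [hlamZP, Real.sq_sqrt (div_pos hZ hP).le]
      exact palinstrophy_mul_length_le hν hTt hZ hP hcL hΘ'1 (le_trans zero_le_one hN₁1) hlam hlam2 hlamL hsparse' hpinl
    -- efficiency at level `ε` (`ε' ≤ ε`)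
    have heffε : (kStar - ε) * M * Real.sqrt (Zen (u t)) * Real.sqrt (Wpa (u t)) ≤ |Jst (u t)| := by
      refine le_trans ?_ heff
      have : (kStar - ε) * M ≤ (kStar - ε') * M := mul_le_mul_of_nonneg_right (by linarith) hM0.le
      exact mul_le_mul_of_nonneg_right (mul_le_mul_of_nonneg_right this (Real.sqrt_nonneg _)) (Real.sqrt_nonneg _)
    -- ### S-B: a fat near-top ball of radius `rλ`
    obtain ⟨x₀, hfat⟩ := hSBv (u t) M B hAdm hReg hSparse hpos heffε
    refine ⟨t, ⟨ht₁t, htT⟩, M, x₀, hM, ?_, hpinu, ?_⟩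
    · exact le_trans (mul_le_mul_of_nonneg_right (min_le_left _ _) hsν.le) hpinl
    · -- parabolic units: `B(x₀, rλ) ⊆ B(x₀, rΘ'√X)` and `c₀(rλ)³ ≥ (c₀/Θ'⁶)(rΘ'√X)³`
      have hrad : r * lam (u t) ≤ r * Θ' * Real.sqrt (ν * (T - t)) := by
        rw [mul_assoc]; exact mul_le_mul_of_nonneg_left hlamU hr.le
      have hvol : c₀ / Θ' ^ 6 * (r * Θ' * Real.sqrt (ν * (T - t))) ^ 3 ≤ c₀ * (r * lam (u t)) ^ 3 := by
        have e : c₀ / Θ' ^ 6 * (r * Θ' * Real.sqrt (ν * (T - t))) ^ 3 = c₀ * (r * (Real.sqrt X / Θ')) ^ 3 := by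
          rw [hXdef]; field_simp
        rw [e]
        gcongr
      calc ENNReal.ofReal (c₀ / Θ' ^ 6 * (r * Θ' * Real.sqrt (ν * (T - t))) ^ 3)
          ≤ ENNReal.ofReal (c₀ * (r * lam (u t)) ^ 3) := ENNReal.ofReal_le_ofReal hvol
        _ ≤ volume {x : EuclideanSpace ℝ (Fin 3) | x ∈ Metric.ball x₀ (r * lam (u t)) ∧ (1 - δ) * M ≤ ‖u t x‖} := hfat
        _ ≤ volume {x : EuclideanSpace ℝ (Fin 3) | x ∈ Metric.ball x₀ (r * Θ' * Real.sqrt (ν * (T - t))) ∧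
              (1 - δ) * M ≤ ‖u t x‖} :=
            measure_mono fun x hx => ⟨Metric.ball_subset_ball hrad hx.1, hx.2⟩
  -- ### (T4) the plateau zoom
  exact plateauZoom C ν T hC hν hT u p hsol hLH hdec hrate key

end Summit.NavierStokesRegularity.NavierStokesRegularity.Theorems.NearExtremalTransiencePerFlow.SparseBangBang

end
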